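import Literature.AlgebraicGeometry.Frobenioids.BaseCategoryTheoreticity
import Literature.AlgebraicGeometry.Frobenioids.DivisorMonoidCategoryTheoreticity
import HarnessLib

/-!
# Frobenioids I, Prop. 3.11 (i) ⇒ the projection `C → F_{0_D} = D × N_{≥1}` is an equivalence

Mochizuki, *The geometry of Frobenioids I: the general theory*, Kyushu J. Math. **62** (2008)
293–400, Prop. 3.11 (i) p. 73 and the proof of Cor. 4.12 p. 95
[cite: MochizukiFrdI2008, Prop. 3.11 (i) p.73]. Proof-only companion (theorems only) of seat
abc-iut-L1-t3's statement files `BaseCategoryTheoreticity.lean` (`PreFrobenioidData.Prop311i`) and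
`DivisorMonoidCategoryTheoreticity.lean` (`PreFrobenioidData.toBaseDeg`); PIECE «BaseDegEquivalence»
handed out by the holder of abc-iut node `FrdI:Cor4.12`, seat abc-iut-L1-d6 (INBOX 2026-08-25T22:30:17Z),
written by seat abc-iut-L1-d5; d6's files are untouched and consume the result by name in
`BaseDegSquare.cor412_of_exists_toBaseDeg_equivalence`.

Content. The typed Prop. 3.11 (i) (`Prop311i S`, for operations `S` of isotropic, unit-trivial and
group-like type over an FSMFF base with `Φ = 0`) unfolds the printed "the functor `C → F_Φ` is an
equivalence of categories" into three clauses: (1) an arrow is determined by `(Base, deg_Fr)`, (2) every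
pair `(f, n)` is realised, (3) every object of `D` is isomorphic to some `Base A`. For the functor
`S.toBaseDeg : C ⥤ D × B(N_{≥1})`, `A ↦ (Base A, *)`, `φ ↦ (Base φ, deg_Fr φ)` — i.e. `C → F_{0_D}` — these
are exactly faithfulness (1), fullness (2) and essential surjectivity (3), whence
`toBaseDeg_isEquivalence_of_prop311i`. This is the step "`(C^birat)^un-tr ⥲ F_{0_D}`" of the proof of
Cor. 4.12 (p. 95), applied there to `((C_i)^birat)^un-tr`. No statement of the paper is strengthened;
nothing here bears on [IUTchIII] Cor. 3.12.
-/

namespace Literature.AlgebraicGeometry.Frobenioids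

open CategoryTheory

universe w v v' u u'

namespace PreFrobenioidData

variable {C : Type u} [Category.{v} C] {D : Type u'} [Category.{v'} D]

/-- Clause (1) of Prop. 3.11 (i) — an arrow is determined by `(Base, deg_Fr)` — is faithfulness of
`C → D × B(N_{≥1})`. [cite: MochizukiFrdI2008, Prop. 3.11 (i) p.73] -/
theorem toBaseDeg_faithful_of_prop311i (S : PreFrobenioidData.{w} C D) (h : Prop311Setting S)
    (h311 : Prop311i S) : S.toBaseDeg.Faithful :=
  ⟨fun {_ _} φ ψ hmap => (h311 h).1 φ ψ (congrArg Prod.fst hmap) (congrArg Prod.snd hmap)⟩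

/-- Clause (2) of Prop. 3.11 (i) — every pair `(f, n)` is realised by an arrow — is fullness of
`C → D × B(N_{≥1})`. [cite: MochizukiFrdI2008, Prop. 3.11 (i) p.73] -/
theorem toBaseDeg_full_of_prop311i (S : PreFrobenioidData.{w} C D) (h : Prop311Setting S)
    (h311 : Prop311i S) : S.toBaseDeg.Full := by
  refine ⟨fun {A B} f => ?_⟩
  obtain ⟨φ, h₁, h₂⟩ := (h311 h).2.1 A B f.1 f.2
  exact ⟨φ, Prod.ext h₁ h₂⟩

/-- Clause (3) of Prop. 3.11 (i) — every object of `D` is isomorphic to some `Base A` — is essential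
surjectivity of `C → D × B(N_{≥1})` (`B(N_{≥1})` has one object). [cite: MochizukiFrdI2008, Prop. 3.11 (i) p.73] -/
theorem toBaseDeg_essSurj_of_prop311i (S : PreFrobenioidData.{w} C D) (h : Prop311Setting S)
    (h311 : Prop311i S) : S.toBaseDeg.EssSurj := by
  refine ⟨fun X => ?_⟩
  obtain ⟨A, ⟨i⟩⟩ := (h311 h).2.2 X.1
  exact ⟨A, ⟨Iso.prod i (Iso.refl _)⟩⟩

/-- **Prop. 3.11 (i) ⇒ `C → F_{0_D}` is an equivalence of categories**: for the operations `S` of a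
Frobenioid in the setting of Prop. 3.11 (`Φ = 0`; isotropic, unit-trivial, group-like type; FSMFF base),
the typed Prop. 3.11 (i) makes the projection `S.toBaseDeg : C ⥤ D × B(N_{≥1})` ("the functor
`C → F_Φ`", `F_{0_D} = D × B(N_{≥1})`) full, faithful and essentially surjective, hence an equivalence
— the step "`(C^birat)^un-tr ⥲ F_{0_D}`" of the proof of Cor. 4.12 (p. 95).
[cite: MochizukiFrdI2008, Prop. 3.11 (i) p.73] -/
theorem toBaseDeg_isEquivalence_of_prop311i (S : PreFrobenioidData.{w} C D) (h : Prop311Setting S)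
    (h311 : Prop311i S) : S.toBaseDeg.IsEquivalence where
  faithful := toBaseDeg_faithful_of_prop311i S h h311
  full := toBaseDeg_full_of_prop311i S h h311
  essSurj := toBaseDeg_essSurj_of_prop311i S h h311

end PreFrobenioidData

end Literature.AlgebraicGeometry.Frobenioids
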